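import Summits.AtomisticToContinuum.Crystallization.Theorems.FreeSplittingCertificatesRadiusLadder

/-!
# `FiniteRangeSplitting` (stmt-AtomisticToContinuum-12559): point-group averaging of splitting rules is free

Support file for crux r2 of route `FreeSplittingCertificates` (block-2b unit `b2b-freesplit-A`, gen 8).
VALUE = a theorem about what the R = 2 recurrent-pattern LP certificates decide — NOT summit progress.

The decisive R = 2 LP cells of the unit (RESULTS-R2 §3: jobs j037417, j037419–21, j038594, j038605) key the
realised bond patterns CANONICALLY UNDER THE FRAME POINT GROUP `O_h` (48 signed coordinate permutations), i.e.
they optimise only over rules `Φ` with `Φ (g v) (g '' T) = Φ v T` for all `g ∈ O_h`, and fix the weight `1/2` on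
every bond whose `O_h`-canonical key coincides with that of its reversal.  This file proves that this restriction
loses nothing, for ANY finite set `G` of linear isometries of `ℝ³` closed under composition:

* `ruleComp g Φ = (v,T) ↦ Φ (g v) (g '' T)` is a rule when `Φ` is (`isRule_ruleComp`), and its site energies on
  `x` are those of `Φ` on `g ∘ x` (`siteE_ruleComp`, via `bondPattern_comp`); separation is `g`-invariant
  (`sep_comp`), so `Feasible δ R Φ → Feasible δ R (ruleComp g Φ)` (`feasible_ruleComp`).
* `groupAvg G Φ = |G|⁻¹ Σ_{g ∈ G} ruleComp g Φ` is a rule (`isRule_groupAvg`), its site energies are the averages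
  (`siteE_groupAvg`), hence it is feasible when `Φ` is (`feasible_groupAvg`) — the rule class and the feasible
  class are convex and isometry-invariant.
* If `G` is closed under composition, `groupAvg G Φ` is `G`-INVARIANT (`groupAvg_invariant`).  Consequently
  `RungAt δ R ↔ ∃ Φ, IsRule Φ ∧ Feasible δ R Φ ∧ (Φ is G-invariant)` (`rungAt_iff_exists_invariant`): W.L.O.G. THE RULE
  IS `G`-INVARIANT, which is the soundness of the `O_h`-keyed LP as a REFUTER of the rung
  (`not_rungAt_of_zoo_invariant`: a finite zoo of `δ`-separated configurations on which every `G`-invariant rule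
  has a deficient site refutes `RungAt δ R`; such a zoo need not be `G`-closed).
* SELF-COMPLEMENTARY KEYS: a `G`-invariant rule gives weight exactly `1/2` to a bond `v ≠ 0` whose reversed key
  `(−v, T − v)` lies in the `G`-orbit of `(v, T)` (`invariant_eq_half`) — the LP's "forced `1/2`" bonds; with
  `g = −1` this is the midpoint-oddness of `…RadiusLadder` (`invAvg_eq_half`), and `G = {1, −1}` recovers
  inversion averaging (`invAvg`, `feasible_invAvg`) — not restated here.

All statements are over the vocabulary of `StrictSplittingRuleBirth` (`IsRule`, `Sep`, `siteE`, `bondPattern`,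
`Feasible`, `RungAt`, `eInf`); nothing here closes an item.
-/

noncomputable section
namespace Summit.AtomisticToContinuum.Crystallization.Theorems.StrictSplittingRuleBirth

open scoped BigOperators Classical
open Literature.MathematicalPhysics.StatisticalMechanics

/-- Euclidean `3`-space. -/
local notation "E3" => EuclideanSpace ℝ (Fin 3)

/-! ## Transport of a rule by one linear isometry -/

/-- The rule `Φ` read through the linear isometry `g`: `(v, T) ↦ Φ (g v) (g '' T)`. [folklore] -/
def ruleComp (g : E3 ≃ₗᵢ[ℝ] E3) (Φ : E3 → Finset E3 → ℝ) : E3 → Finset E3 → ℝ :=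
  fun v T => Φ (g v) (T.image g)

/-- Translating a pattern and then applying `g` = applying `g` and translating by `g v`. [folklore] -/
theorem image_sub_image_eq (g : E3 ≃ₗᵢ[ℝ] E3) (v : E3) (T : Finset E3) :
    (T.image fun u => u - v).image g = (T.image g).image fun u => u - g v := by
  rw [Finset.image_image, Finset.image_image]
  congr 1
  funext u
  simp only [Function.comp_apply, map_sub]

/-- A transported rule is a rule. -/
theorem isRule_ruleComp (g : E3 ≃ₗᵢ[ℝ] E3) {Φ : E3 → Finset E3 → ℝ} (h : IsRule Φ) :
    IsRule (ruleComp g Φ) := by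
  refine ⟨fun v T => h.1 (g v) (T.image g), fun v T hv => ?_⟩
  have hgv : g v ≠ 0 := fun h0 => hv (by simpa using congrArg g.symm h0)
  have e := h.2 (g v) (T.image g) hgv
  unfold ruleComp
  rw [map_neg, image_sub_image_eq]
  exact e

/-- Bond patterns of `g ∘ x` are the `g`-images of the bond patterns of `x`. [folklore] -/
theorem bondPattern_comp (g : E3 ≃ₗᵢ[ℝ] E3) (R : ℝ) {N : ℕ} (x : Fin N → E3) (i j : Fin N) :
    bondPattern R (fun k => g (x k)) i j = (bondPattern R x i j).image g := by
  unfold bondPattern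
  rw [Finset.image_image]
  have hf : (Finset.univ.filter fun l => dist (g (x l)) (g (x i)) ≤ R ∨ dist (g (x l)) (g (x j)) ≤ R) =
      Finset.univ.filter fun l => dist (x l) (x i) ≤ R ∨ dist (x l) (x j) ≤ R := by
    simp only [LinearIsometryEquiv.dist_map]
  rw [hf]
  congr 1
  funext l
  simp only [Function.comp_apply, map_sub]

/-- Site energies of `Φ` on `g ∘ x` are those of `ruleComp g Φ` on `x`. [folklore] -/
theorem siteE_ruleComp (g : E3 ≃ₗᵢ[ℝ] E3) (R : ℝ) (Φ : E3 → Finset E3 → ℝ) {N : ℕ} (x : Fin N → E3)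
    (i : Fin N) : siteE R Φ (fun k => g (x k)) i = siteE R (ruleComp g Φ) x i := by
  rw [perturbative_siteE_eq, perturbative_siteE_eq]
  refine Finset.sum_congr rfl fun j _ => ?_
  rw [bondPattern_comp, LinearIsometryEquiv.dist_map, ← map_sub]
  rfl

/-- Separation is invariant under isometries. [folklore] -/
theorem sep_comp (g : E3 ≃ₗᵢ[ℝ] E3) {δ : ℝ} {N : ℕ} {x : Fin N → E3} (hx : Sep δ x) :
    Sep δ (fun k => g (x k)) := by
  intro i j hij
  show δ ≤ dist (g (x i)) (g (x j))
  rw [LinearIsometryEquiv.dist_map]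
  exact hx i j hij

/-- **Transport is free**: a feasible rule stays feasible when read through a linear isometry. -/
theorem feasible_ruleComp (g : E3 ≃ₗᵢ[ℝ] E3) {δ R : ℝ} {Φ : E3 → Finset E3 → ℝ} (hf : Feasible δ R Φ) :
    Feasible δ R (ruleComp g Φ) := by
  intro N x hx i
  rw [← siteE_ruleComp]
  exact hf N (fun k => g (x k)) (sep_comp g hx) i

/-! ## Averaging over a finite set of isometries -/

/-- The average of the transports of `Φ` over a finite set `G` of linear isometries. [folklore] -/
def groupAvg (G : Finset (E3 ≃ₗᵢ[ℝ] E3)) (Φ : E3 → Finset E3 → ℝ) : E3 → Finset E3 → ℝ :=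
  fun v T => (∑ g ∈ G, Φ (g v) (T.image g)) / (G.card : ℝ)

/-- The average over a nonempty finite set of isometries of a rule is a rule (the rule class is convex and
isometry-invariant). -/
theorem isRule_groupAvg {G : Finset (E3 ≃ₗᵢ[ℝ] E3)} (hG : G.Nonempty) {Φ : E3 → Finset E3 → ℝ}
    (h : IsRule Φ) : IsRule (groupAvg G Φ) := by
  have hc : (0 : ℝ) < G.card := by exact_mod_cast hG.card_pos
  refine ⟨fun v T => ⟨?_, ?_⟩, fun v T hv => ?_⟩
  · exact div_nonneg (Finset.sum_nonneg fun g _ => (h.1 _ _).1) hc.le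
  · rw [groupAvg, div_le_one hc]
    calc ∑ g ∈ G, Φ (g v) (T.image g) ≤ ∑ _g ∈ G, (1 : ℝ) := Finset.sum_le_sum fun g _ => (h.1 _ _).2
      _ = G.card := by simp
  · unfold groupAvg
    rw [← add_div, ← Finset.sum_add_distrib, div_eq_one_iff_eq hc.ne']
    calc ∑ g ∈ G, (Φ (g v) (T.image g) + Φ (g (-v)) ((T.image fun u => u - v).image g))
        = ∑ _g ∈ G, (1 : ℝ) := by
          refine Finset.sum_congr rfl fun g _ => ?_
          have := (isRule_ruleComp g h).2 v T hv
          simpa [ruleComp] using this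
      _ = G.card := by simp

/-- Site energies of the average are the averages of the site energies on the transported configurations. -/
theorem siteE_groupAvg {G : Finset (E3 ≃ₗᵢ[ℝ] E3)} (hG : G.Nonempty) (R : ℝ) (Φ : E3 → Finset E3 → ℝ)
    {N : ℕ} (x : Fin N → E3) (i : Fin N) :
    siteE R (groupAvg G Φ) x i = (∑ g ∈ G, siteE R Φ (fun k => g (x k)) i) / (G.card : ℝ) := by
  have hc : (G.card : ℝ) ≠ 0 := by exact_mod_cast hG.card_pos.ne'
  rw [perturbative_siteE_eq]
  have e1 : ∀ g ∈ G, siteE R Φ (fun k => g (x k)) i =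
      ∑ j ∈ Finset.univ.erase i, Φ (g (x j - x i)) ((bondPattern R x i j).image g) *
        lennardJones (dist (x i) (x j)) := by
    intro g _
    rw [siteE_ruleComp, perturbative_siteE_eq]
    rfl
  rw [Finset.sum_congr rfl e1, Finset.sum_comm, Finset.sum_div]
  refine Finset.sum_congr rfl fun j _ => ?_
  rw [groupAvg, div_mul_eq_mul_div, Finset.sum_mul]

/-- **Averaging is free**: a feasible rule has a feasible average over any nonempty finite set of isometries. -/
theorem feasible_groupAvg {G : Finset (E3 ≃ₗᵢ[ℝ] E3)} (hG : G.Nonempty) {δ R : ℝ} {Φ : E3 → Finset E3 → ℝ}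
    (hf : Feasible δ R Φ) : Feasible δ R (groupAvg G Φ) := by
  intro N x hx i
  have hc : (0 : ℝ) < G.card := by exact_mod_cast hG.card_pos
  rw [siteE_groupAvg hG, le_div_iff₀ hc]
  calc eInf * G.card = ∑ _g ∈ G, eInf := by simp [mul_comm]
    _ ≤ ∑ g ∈ G, siteE R Φ (fun k => g (x k)) i :=
        Finset.sum_le_sum fun g _ => hf N (fun k => g (x k)) (sep_comp g hx) i

/-! ## Invariance when `G` is closed under composition

Below, `G`-INVARIANCE of a rule `Φ` is spelled out as `∀ g ∈ G, ∀ v T, Φ (g v) (T.image g) = Φ v T` (no new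
`Prop` definition is introduced). -/

/-- Right translation by a member permutes a finite set of equivalences closed under composition. [folklore] -/
theorem image_trans_eq {G : Finset (E3 ≃ₗᵢ[ℝ] E3)} (hmul : ∀ g ∈ G, ∀ h ∈ G, g.trans h ∈ G)
    {g₀ : E3 ≃ₗᵢ[ℝ] E3} (hg₀ : g₀ ∈ G) : G.image (fun g => g₀.trans g) = G := by
  have hinj : Function.Injective fun g : E3 ≃ₗᵢ[ℝ] E3 => g₀.trans g := by
    intro g g' hgg'
    refine LinearIsometryEquiv.ext fun u => ?_
    have := congrArg (fun e : E3 ≃ₗᵢ[ℝ] E3 => e (g₀.symm u)) hgg'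
    simpa [LinearIsometryEquiv.trans_apply] using this
  apply Finset.eq_of_subset_of_card_le
  · intro h hh
    obtain ⟨g, hg, rfl⟩ := Finset.mem_image.mp hh
    exact hmul g₀ hg₀ g hg
  · rw [Finset.card_image_of_injective _ hinj]

/-- **The average over a composition-closed finite set of isometries is invariant under it.** -/
theorem groupAvg_invariant {G : Finset (E3 ≃ₗᵢ[ℝ] E3)} (hmul : ∀ g ∈ G, ∀ h ∈ G, g.trans h ∈ G)
    (Φ : E3 → Finset E3 → ℝ) :
    ∀ g₀ ∈ G, ∀ (v : E3) (T : Finset E3), groupAvg G Φ (g₀ v) (T.image g₀) = groupAvg G Φ v T := by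
  intro g₀ hg₀ v T
  unfold groupAvg
  congr 1
  have hinj : ∀ g ∈ G, ∀ g' ∈ G, g₀.trans g = g₀.trans g' → g = g' := by
    intro g _ g' _ hgg'
    refine LinearIsometryEquiv.ext fun u => ?_
    have := congrArg (fun e : E3 ≃ₗᵢ[ℝ] E3 => e (g₀.symm u)) hgg'
    simpa [LinearIsometryEquiv.trans_apply] using this
  calc ∑ g ∈ G, Φ (g (g₀ v)) ((T.image g₀).image g)
      = ∑ g ∈ G, Φ ((g₀.trans g) v) (T.image (g₀.trans g)) := by
        refine Finset.sum_congr rfl fun g _ => ?_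
        rw [LinearIsometryEquiv.trans_apply, Finset.image_image]
        rfl
    _ = ∑ h ∈ G.image (fun g => g₀.trans g), Φ (h v) (T.image h) :=
        (Finset.sum_image (f := fun h : E3 ≃ₗᵢ[ℝ] E3 => Φ (h v) (T.image h)) hinj).symm
    _ = ∑ h ∈ G, Φ (h v) (T.image h) := by rw [image_trans_eq hmul hg₀]

/-- **W.l.o.g. the rule is `G`-invariant**: for a nonempty finite set `G` of linear isometries closed under
composition, a rung exists iff an invariant rung exists. -/
theorem rungAt_iff_exists_invariant {G : Finset (E3 ≃ₗᵢ[ℝ] E3)} (hG : G.Nonempty)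
    (hmul : ∀ g ∈ G, ∀ h ∈ G, g.trans h ∈ G) (δ R : ℝ) :
    RungAt δ R ↔ ∃ Φ : E3 → Finset E3 → ℝ, IsRule Φ ∧ Feasible δ R Φ ∧
      ∀ g ∈ G, ∀ (v : E3) (T : Finset E3), Φ (g v) (T.image g) = Φ v T := by
  constructor
  · rintro ⟨Φ, hr, hf⟩
    exact ⟨groupAvg G Φ, isRule_groupAvg hG hr, feasible_groupAvg hG hf, groupAvg_invariant hmul Φ⟩
  · rintro ⟨Φ, hr, hf, -⟩
    exact ⟨Φ, hr, hf⟩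

/-- **Soundness of the symmetry-reduced LP as a refuter.**  A finite zoo of `δ`-separated configurations on
which every `G`-INVARIANT rule has a site with weighted energy `< e_∞` refutes `RungAt δ R` (the zoo itself need
not be closed under `G`). -/
theorem not_rungAt_of_zoo_invariant {G : Finset (E3 ≃ₗᵢ[ℝ] E3)} (hG : G.Nonempty)
    (hmul : ∀ g ∈ G, ∀ h ∈ G, g.trans h ∈ G) {δ R : ℝ} (Z : Finset (Σ N : ℕ, Fin N → E3))
    (hsep : ∀ c ∈ Z, Sep δ c.2)
    (h : ∀ Φ : E3 → Finset E3 → ℝ, IsRule Φ → (∀ g ∈ G, ∀ (v : E3) (T : Finset E3), Φ (g v) (T.image g) = Φ v T) →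
      ∃ c ∈ Z, ∃ i : Fin c.1, siteE R Φ c.2 i < eInf) :
    ¬ RungAt δ R := by
  intro hr
  obtain ⟨Φ, hrule, hf, hinv⟩ := (rungAt_iff_exists_invariant hG hmul δ R).mp hr
  obtain ⟨c, hc, i, hi⟩ := h Φ hrule hinv
  exact absurd (hf c.1 c.2 (hsep c hc) i) (not_le.mpr hi)

/-- **Self-complementary keys get weight `1/2`.**  If the reversed key `(−v, T − v)` of a bond `v ≠ 0` is the
`g`-image of its key for some `g ∈ G`, every `G`-invariant rule gives the bond weight exactly `1/2`. -/
theorem invariant_eq_half {G : Finset (E3 ≃ₗᵢ[ℝ] E3)} {Φ : E3 → Finset E3 → ℝ} (hr : IsRule Φ)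
    (hinv : ∀ g ∈ G, ∀ (v : E3) (T : Finset E3), Φ (g v) (T.image g) = Φ v T) {v : E3} (hv : v ≠ 0) {T : Finset E3} {g : E3 ≃ₗᵢ[ℝ] E3} (hg : g ∈ G)
    (hgv : g v = -v) (hgT : T.image g = T.image fun u => u - v) : Φ v T = 1 / 2 := by
  have hc := hr.2 v T hv
  have hi := hinv g hg v T
  rw [hgv, hgT] at hi
  linarith

/-- The midpoint-symmetric case (`g = −1`, cf. `invAvg_eq_half`): an inversion-invariant rule gives weight
`1/2` to a bond whose pattern satisfies `T = v − T`. -/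
example {G : Finset (E3 ≃ₗᵢ[ℝ] E3)} {Φ : E3 → Finset E3 → ℝ} (hr : IsRule Φ)
    (hinv : ∀ g ∈ G, ∀ (v : E3) (T : Finset E3), Φ (g v) (T.image g) = Φ v T)
    (hneg : LinearIsometryEquiv.neg ℝ ∈ G) {v : E3} (hv : v ≠ 0) {T : Finset E3}
    (hT : T.image (fun u => v - u) = T) : Φ v T = 1 / 2 := by
  refine invariant_eq_half hr hinv hv hneg (by simp) ?_
  conv_rhs => rw [← hT]
  rw [Finset.image_image]
  congr 1
  funext u
  simp

/-- The hypotheses are met by `G = {1, −1}` (inversion averaging, cf. `invAvg`): it is closed under composition. -/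
example : ∀ g ∈ ({LinearIsometryEquiv.refl ℝ E3, LinearIsometryEquiv.neg ℝ} : Finset (E3 ≃ₗᵢ[ℝ] E3)),
    ∀ h ∈ ({LinearIsometryEquiv.refl ℝ E3, LinearIsometryEquiv.neg ℝ} : Finset (E3 ≃ₗᵢ[ℝ] E3)),
      g.trans h ∈ ({LinearIsometryEquiv.refl ℝ E3, LinearIsometryEquiv.neg ℝ} : Finset (E3 ≃ₗᵢ[ℝ] E3)) := by
  have hnn : (LinearIsometryEquiv.neg ℝ : E3 ≃ₗᵢ[ℝ] E3).trans (LinearIsometryEquiv.neg ℝ) =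
      LinearIsometryEquiv.refl ℝ E3 :=
    LinearIsometryEquiv.ext fun u => by simp [LinearIsometryEquiv.trans_apply]
  intro g hg h hh
  simp only [Finset.mem_insert, Finset.mem_singleton] at hg hh ⊢
  rcases hg with rfl | rfl <;> rcases hh with rfl | rfl
  · exact Or.inl rfl
  · exact Or.inr rfl
  · exact Or.inr rfl
  · exact Or.inl hnn

end Summit.AtomisticToContinuum.Crystallization.Theorems.StrictSplittingRuleBirth

end
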